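import Mathlib
import Summits.Ventures.PercRepro2.Defs
import Summits.Ventures.PercRepro2.Independence
import Summits.Ventures.PercRepro2.Harris
import Summits.Ventures.PercRepro2.Graph
import Summits.Ventures.PercRepro2.Exploration
import Summits.Ventures.PercRepro2.Events
import Summits.Ventures.PercRepro2.FourFunctions
import Summits.Ventures.PercRepro2.Induced
import Summits.Ventures.PercRepro2.Frontier
import Summits.Ventures.PercRepro2.ObsIndependence
import Summits.Ventures.PercRepro2.BHK
import Summits.Ventures.PercRepro2.BHKEvents
import Summits.Ventures.PercRepro2.VdBKahn
import Summits.Ventures.PercRepro2.BHKAvoid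

/-!
# BHK for events outside the explored cluster (blind cell PercRepro2, mine-2 g17)

Two corollaries of the functional BHK inequality `bhk_induced` (BHK06 Thm 1.3: the cluster `C_s`
is positively associated conditionally on `s ↮ X`) for events that live in `G ∖ C_s` (cluster
events of OTHER vertices `u` together with `u ∉ C_s`):

* `bhk_two_outside_avoid` (two outside events, POSITIVE): for up-sets `𝓤, 𝓥` and vertices `u, v`,
  `P(C_u ∈ 𝓤, s↮X∪{u}) · P(C_v ∈ 𝓥, s↮X∪{v}) ≤ P(C_u ∈ 𝓤, C_v ∈ 𝓥, s↮X∪{u,v}) · P(s↮X)`;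
* `bhk_inside_outside_avoid` (one inside, one outside event, NEGATIVE): for a vertex `t`,
  `P(C_s ∈ 𝓤, C_t ∈ 𝓥, s↮X∪{t}) · P(s↮X) ≤ P(C_s ∈ 𝓤, s↮X) · P(C_t ∈ 𝓥, s↮X∪{t})`.

Proof: explore `C_s`. With `g_u(W) = 1[u ∉ W] · P(C_u ∈ 𝓤 in G ∖ W)` (`outsideProb`; antitone in
`W`, in `[0, 1]`) the tower identity gives `P(C_u ∈ 𝓤, s↮X∪{u}) = E[g_u(C_s) 1_{s↮X}]`
(`prob_outside_inter_avoid_eq_expect`) and Harris on `G ∖ W`, fibre by fibre, gives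
`P(C_u ∈ 𝓤, C_v ∈ 𝓥, s↮X∪{u,v}) ≥ E[g_u(C_s) g_v(C_s) 1_{s↮X}]` (`expect_outside_mul_le_prob`);
then `bhk_induced` with `F_i = 1 − g_i` (nonnegative, monotone), multiplied out; the second
inequality is the same with `F₁ = 1_𝓤`. These are the block theorems behind the `CH` and `MIX`
blocks of the a₃-hub certificates (`HubCert3Part1–6.lean`, proofs/MINE2-A3FIRST.md §8.3).
-/

namespace Summit.Ventures.PercRepro2

section OutsideProb

variable {V : Type*} {E : Type*} [Fintype E] [DecidableEq E] {R : Type*} [CommRing R]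

open Classical in
/-- `g_u(W) = 1[u ∉ W] · P(C_u ∈ 𝓤 in G ∖ W)`: the probability that the cluster of `u` after closing
every edge touching `W` lies in `𝓤`, killed when `u ∈ W`. -/
noncomputable def outsideProb (p : E → R) (ends : E → Sym2 V) (u : V) (𝓤 : Set (Set V))
    (W : Set V) : R :=
  if u ∈ W then 0 else delClusterProb p ends u 𝓤 W

variable {ends : E → Sym2 V}

/-- `outsideProb` when `u ∈ W`. -/
lemma outsideProb_apply_of_mem (p : E → R) {u : V} (𝓤 : Set (Set V)) {W : Set V} (h : u ∈ W) :
    outsideProb p ends u 𝓤 W = 0 := by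
  simp [outsideProb, h]

/-- `outsideProb` when `u ∉ W`. -/
lemma outsideProb_apply_of_notMem (p : E → R) {u : V} (𝓤 : Set (Set V)) {W : Set V}
    (h : u ∉ W) : outsideProb p ends u 𝓤 W = delClusterProb p ends u 𝓤 W := by
  simp [outsideProb, h]

variable [LinearOrder R] [IsStrictOrderedRing R]

/-- `0 ≤ g_u`. -/
lemma outsideProb_nonneg {p : E → R} (hp : IsProbVec p) (ends : E → Sym2 V) (u : V) (𝓤 : Set (Set V))
    (W : Set V) :
    0 ≤ outsideProb p ends u 𝓤 W := by
  by_cases h : u ∈ W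
  · rw [outsideProb_apply_of_mem p 𝓤 h]
  · rw [outsideProb_apply_of_notMem p 𝓤 h]
    exact delClusterProb_nonneg p hp ends u 𝓤 W

/-- `g_u ≤ 1`. -/
lemma outsideProb_le_one {p : E → R} (hp : IsProbVec p) (ends : E → Sym2 V) (u : V) (𝓤 : Set (Set V))
    (W : Set V) :
    outsideProb p ends u 𝓤 W ≤ 1 := by
  by_cases h : u ∈ W
  · rw [outsideProb_apply_of_mem p 𝓤 h]
    exact zero_le_one
  · rw [outsideProb_apply_of_notMem p 𝓤 h]
    exact delClusterProb_le_one p hp ends u 𝓤 W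

/-- For an up-set `𝓤`, `g_u` is antitone in `W`. -/
lemma outsideProb_anti {p : E → R} (hp : IsProbVec p) (ends : E → Sym2 V) (u : V)
    {𝓤 : Set (Set V)} (h𝓤 : IsUpperSet 𝓤) : Antitone (outsideProb p ends u 𝓤) := by
  intro W W' hWW'
  by_cases h' : u ∈ W'
  · rw [outsideProb_apply_of_mem p 𝓤 h']
    exact outsideProb_nonneg hp ends u 𝓤 W
  · have h : u ∉ W := fun hu => h' (hWW' hu)
    rw [outsideProb_apply_of_notMem p 𝓤 h', outsideProb_apply_of_notMem p 𝓤 h]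
    exact delClusterProb_anti p hp ends u h𝓤 hWW'

end OutsideProb

section Tower

variable {V : Type*} {E : Type*} [Fintype E] [DecidableEq E] [Fintype V] [DecidableEq V]
  {R : Type*} [CommRing R]

omit [Fintype E] [DecidableEq E] [Fintype V] in
/-- `s ↮ X ∪ {u}` is `u ∉ C_s` and `s ↮ X`. -/
lemma mem_avoidAll_insert_iff {ends : E → Sym2 V} {s u : V} {X : Finset V} {ω : Config E} :
    ω ∈ avoidAll ends s (insert u X) ↔ u ∉ cluster ends ω s ∧ ω ∈ avoidAll ends s X := by
  simp only [mem_avoidAll, Finset.mem_insert, forall_eq_or_imp, mem_cluster]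

/-- **Exploring the cluster of `s`, one outside event**:
`P(C_s ∈ 𝓤, C_u ∈ 𝓥, s ↮ X ∪ {u}) = E[1_𝓤(C_s) · g_u(C_s) · 1_{s↮X}]` with `g_u = outsideProb`. -/
theorem prob_clusterIn_outside_inter_avoid_eq_expect (p : E → R) (ends : E → Sym2 V) (s u : V)
    (X : Finset V) (𝓤 𝓥 : Set (Set V)) :
    prob p (clusterInEvent ends s 𝓤 ∩ clusterInEvent ends u 𝓥 ∩ avoidAll ends s (insert u X)) =
      expect p (fun ω => 𝓤.indicator 1 (cluster ends ω s) *
        outsideProb p ends u 𝓥 (cluster ends ω s) * (avoidAll ends s X).indicator 1 ω) := by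
  rw [prob_clusterIn_inter_avoid_eq_expect p ends s u (Finset.mem_insert_self u X) 𝓤 𝓥]
  congr 1
  funext ω
  by_cases hu : u ∈ cluster ends ω s
  · have hnot : ω ∉ avoidAll ends s (insert u X) :=
      fun hav => (mem_avoidAll_insert_iff.1 hav).1 hu
    rw [Set.indicator_of_notMem hnot, outsideProb_apply_of_mem p 𝓥 hu]
    simp
  · rw [outsideProb_apply_of_notMem p 𝓥 hu]
    by_cases hav : ω ∈ avoidAll ends s X
    · rw [Set.indicator_of_mem (mem_avoidAll_insert_iff.2 ⟨hu, hav⟩), Set.indicator_of_mem hav]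
    · rw [Set.indicator_of_notMem (fun h => hav (mem_avoidAll_insert_iff.1 h).2),
        Set.indicator_of_notMem hav]

/-- **Exploring the cluster of `s`, one outside event, no inside event**:
`P(C_u ∈ 𝓥, s ↮ X ∪ {u}) = E[g_u(C_s) · 1_{s↮X}]`. -/
theorem prob_outside_inter_avoid_eq_expect (p : E → R) (ends : E → Sym2 V) (s u : V)
    (X : Finset V) (𝓥 : Set (Set V)) :
    prob p (clusterInEvent ends u 𝓥 ∩ avoidAll ends s (insert u X)) =
      expect p (fun ω => outsideProb p ends u 𝓥 (cluster ends ω s) *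
        (avoidAll ends s X).indicator 1 ω) := by
  have h := prob_clusterIn_outside_inter_avoid_eq_expect p ends s u X Set.univ 𝓥
  have e : clusterInEvent ends s Set.univ ∩ clusterInEvent ends u 𝓥 ∩
      avoidAll ends s (insert u X) = clusterInEvent ends u 𝓥 ∩ avoidAll ends s (insert u X) := by
    ext ω; simp [clusterInEvent]
  rw [e] at h
  rw [h]
  congr 1
  funext ω
  simp only [Set.indicator_univ, Pi.one_apply, one_mul]

omit [Fintype E] [DecidableEq E] [Fintype V] [DecidableEq V] in
/-- `delConfig` is monotone in the configuration. -/
lemma delConfig_mono_of_le (ends : E → Sym2 V) (W : Set V) {ω ω' : Config E} (h : ω ≤ ω') :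
    delConfig ends W ω ≤ delConfig ends W ω' := by
  intro e
  by_cases he : e ∈ touches ends W
  · rw [delConfig_apply_of_mem he, delConfig_apply_of_mem he]
  · rw [delConfig_apply_of_notMem he, delConfig_apply_of_notMem he]
    exact h e

variable [LinearOrder R] [IsStrictOrderedRing R]

omit [Fintype V] [DecidableEq V] in
/-- **Harris on `G ∖ W`**: `P(C_u ∈ 𝓤 in G∖W, C_v ∈ 𝓥 in G∖W) ≥ P(C_u ∈ 𝓤 in G∖W) · P(C_v ∈ 𝓥 in G∖W)`
for up-sets `𝓤, 𝓥`. -/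
lemma delClusterProb_mul_le {p : E → R} (hp : IsProbVec p) (ends : E → Sym2 V) (u v : V)
    {𝓤 𝓥 : Set (Set V)} (h𝓤 : IsUpperSet 𝓤) (h𝓥 : IsUpperSet 𝓥) (W : Set V) :
    delClusterProb p ends u 𝓤 W * delClusterProb p ends v 𝓥 W ≤
      prob p ({ω | cluster ends (delConfig ends W ω) u ∈ 𝓤} ∩
        {ω | cluster ends (delConfig ends W ω) v ∈ 𝓥}) := by
  have hA : IsUpperSet {ω : Config E | cluster ends (delConfig ends W ω) u ∈ 𝓤} :=
    fun _ _ h hω => h𝓤 (cluster_mono (delConfig_mono_of_le ends W h) u) hω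
  have hB : IsUpperSet {ω : Config E | cluster ends (delConfig ends W ω) v ∈ 𝓥} :=
    fun _ _ h hω => h𝓥 (cluster_mono (delConfig_mono_of_le ends W h) v) hω
  exact prob_mul_prob_le_prob_inter hp hA hB

/-- **Exploring the cluster of `s`, two outside events** (inequality, by Harris on `G ∖ C_s`):
`E[g_u(C_s) · g_v(C_s) · 1_{s↮X}] ≤ P(C_u ∈ 𝓤, C_v ∈ 𝓥, s ↮ X ∪ {u, v})`. -/
theorem expect_outside_mul_le_prob {p : E → R} (hp : IsProbVec p) (ends : E → Sym2 V) (s u v : V)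
    (X : Finset V) {𝓤 𝓥 : Set (Set V)} (h𝓤 : IsUpperSet 𝓤) (h𝓥 : IsUpperSet 𝓥) :
    expect p (fun ω => outsideProb p ends u 𝓤 (cluster ends ω s) *
        outsideProb p ends v 𝓥 (cluster ends ω s) * (avoidAll ends s X).indicator 1 ω) ≤
      prob p (clusterInEvent ends u 𝓤 ∩ clusterInEvent ends v 𝓥 ∩
        avoidAll ends s (insert u (insert v X))) := by
  classical
  -- `𝓐` describes `{s ↮ X ∪ {u, v}}` through the cluster of `s`
  let 𝓐 : Set (Set V) := {W | (∀ x ∈ X, x ∉ W) ∧ u ∉ W ∧ v ∉ W}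
  have hA : ∀ ω, ω ∈ avoidAll ends s (insert u (insert v X)) ↔ cluster ends ω s ∈ 𝓐 := by
    intro ω
    rw [mem_avoidAll_insert_iff, mem_avoidAll_insert_iff]
    simp only [𝓐, Set.mem_setOf_eq, mem_avoidAll, mem_cluster]
    tauto
  let c : Set V → R := fun W => 𝓐.indicator 1 W
  let D : Set V → Config E → R := fun W =>
    ({ω | cluster ends (delConfig ends W ω) u ∈ 𝓤} ∩
      {ω | cluster ends (delConfig ends W ω) v ∈ 𝓥} : Set (Config E)).indicator 1
  let Φ : Set V → Config E → R := fun W ω => c W * D W ω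
  have hΦ : ∀ W, DependsOn (Φ W) (touches ends W)ᶜ := by
    intro W ω ω' h
    simp only [Φ, D]
    congr 1
    refine dependsOn_indicator (R := R) (fun ω ω' h => ?_) h
    show (cluster ends (delConfig ends W ω) u ∈ 𝓤 ∧ cluster ends (delConfig ends W ω) v ∈ 𝓥) =
      (cluster ends (delConfig ends W ω') u ∈ 𝓤 ∧ cluster ends (delConfig ends W ω') v ∈ 𝓥)
    rw [delConfig_congr h]
  have hS : ∀ W : Set V, DependsOn (· ∈ {ω | cluster ends ω s = W}) (touches ends W) :=
    fun W => dependsOn_clusterEvent ends s W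
  have hdisj : ∀ W : Set V, Disjoint (touches ends W) (touches ends W)ᶜ :=
    fun W => disjoint_compl_right
  -- pointwise: the indicator of the event is `Φ (C_s ω) ω`
  have hpt : ∀ ω, (clusterInEvent ends u 𝓤 ∩ clusterInEvent ends v 𝓥 ∩
      avoidAll ends s (insert u (insert v X))).indicator (1 : Config E → R) ω =
      Φ (cluster ends ω s) ω := by
    intro ω
    simp only [Φ, c, D]
    by_cases hav : ω ∈ avoidAll ends s (insert u (insert v X))
    · have hav' := (hA ω).1 hav
      have eu := cluster_delConfig_cluster (ends := ends) (ω := ω) (s := s) hav'.2.1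
      have ev := cluster_delConfig_cluster (ends := ends) (ω := ω) (s := s) hav'.2.2
      simp only [Set.indicator_apply, Set.mem_inter_iff, Set.mem_setOf_eq, mem_clusterInEvent, eu,
        ev, hav, hav', and_true, if_true, Pi.one_apply, one_mul]
    · have h𝓐 : cluster ends ω s ∉ 𝓐 := fun h => hav ((hA ω).2 h)
      simp [Set.indicator_apply, hav, h𝓐]
  -- the fibre expectation dominates the product of the two outside probabilities
  have hΦexp : ∀ W, c W * (delClusterProb p ends u 𝓤 W * delClusterProb p ends v 𝓥 W) ≤
      expect p (Φ W) := by
    intro W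
    simp only [Φ, D]
    rw [expect_const_mul, ← prob_eq_expect_indicator]
    refine mul_le_mul_of_nonneg_left (delClusterProb_mul_le hp ends u v h𝓤 h𝓥 W) ?_
    exact Set.indicator_apply_nonneg fun _ => zero_le_one
  -- pointwise: the integrand is at most `c (C_s ω) · g_u g_v (C_s ω)`
  have hpt2 : ∀ ω, outsideProb p ends u 𝓤 (cluster ends ω s) *
      outsideProb p ends v 𝓥 (cluster ends ω s) * (avoidAll ends s X).indicator 1 ω ≤
      c (cluster ends ω s) * (delClusterProb p ends u 𝓤 (cluster ends ω s) *
        delClusterProb p ends v 𝓥 (cluster ends ω s)) := by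
    intro ω
    simp only [c]
    by_cases hav : ω ∈ avoidAll ends s (insert u (insert v X))
    · have hav' := (hA ω).1 hav
      have hX : ω ∈ avoidAll ends s X :=
        (mem_avoidAll_insert_iff.1 (mem_avoidAll_insert_iff.1 hav).2).2
      rw [Set.indicator_of_mem hav', Set.indicator_of_mem hX, outsideProb_apply_of_notMem p 𝓤 hav'.2.1,
        outsideProb_apply_of_notMem p 𝓥 hav'.2.2]
      simp
    · rw [Set.indicator_of_notMem (show cluster ends ω s ∉ 𝓐 from fun h => hav ((hA ω).2 h)),
        zero_mul]
      by_cases hu : u ∈ cluster ends ω s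
      · rw [outsideProb_apply_of_mem p 𝓤 hu]; simp
      by_cases hv : v ∈ cluster ends ω s
      · rw [outsideProb_apply_of_mem p 𝓥 hv]; simp
      rw [Set.indicator_of_notMem (fun hX => hav (mem_avoidAll_insert_iff.2
        ⟨hu, mem_avoidAll_insert_iff.2 ⟨hv, hX⟩⟩))]
      simp
  rw [prob_eq_expect_indicator]
  have e1 : (clusterInEvent ends u 𝓤 ∩ clusterInEvent ends v 𝓥 ∩
      avoidAll ends s (insert u (insert v X))).indicator (1 : Config E → R) =
      fun ω => Φ (cluster ends ω s) ω :=
    funext hpt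
  rw [e1, expect_tower p hdisj (S := fun ω => cluster ends ω s) hS hΦ]
  unfold expect
  refine Finset.sum_le_sum fun ω _ => ?_
  refine mul_le_mul_of_nonneg_left ((hpt2 ω).trans (hΦexp _)) (weight_nonneg hp ω)

end Tower

section Main

variable {V : Type*} {E : Type*} [Fintype E] [DecidableEq E] [Fintype V] [DecidableEq V]
  {R : Type*} [CommRing R] [LinearOrder R] [IsStrictOrderedRing R]

omit [DecidableEq V] in
/-- The functional BHK inequality `bhk_induced` on the whole graph, in cluster form. -/
lemma bhk_univ_avoid (p : E → R) (hp : IsProbVec p) (ends : E → Sym2 V) (s : V) (X : Finset V)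
    {F₁ F₂ : Set V → R} (hF₁ : Monotone F₁) (hF₂ : Monotone F₂) (hF₁0 : ∀ S, 0 ≤ F₁ S)
    (hF₂0 : ∀ S, 0 ≤ F₂ S) :
    expect p (fun ω => F₁ (cluster ends ω s) * (avoidAll ends s X).indicator 1 ω) *
        expect p (fun ω => F₂ (cluster ends ω s) * (avoidAll ends s X).indicator 1 ω) ≤
      expect p (fun ω => F₁ (cluster ends ω s) * F₂ (cluster ends ω s) *
        (avoidAll ends s X).indicator 1 ω) * prob p (avoidAll ends s X) := by
  classical
  have key := bhk_induced p hp ends s hF₁ hF₂ hF₁0 hF₂0 Finset.univ X X (Finset.subset_univ _)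
    (Finset.subset_univ _)
  simp only [Finset.inter_self, Finset.union_self, REvent_univ] at key
  have e : ∀ F : Set V → R, clusterObs ends Finset.univ s F * (avoidAll ends s X).indicator 1 =
      fun ω => F (cluster ends ω s) * (avoidAll ends s X).indicator 1 ω := by
    intro F
    funext ω
    simp only [Pi.mul_apply, clusterObs_apply, clusterIn_univ]
  rw [e, e, e] at key
  simpa only [Pi.mul_apply] using key

/-- **BHK, two outside events, with set avoidance** (positive): for up-sets `𝓤, 𝓥` and vertices
`u, v`, `P(C_u ∈ 𝓤, s↮X∪{u}) · P(C_v ∈ 𝓥, s↮X∪{v}) ≤ P(C_u ∈ 𝓤, C_v ∈ 𝓥, s↮X∪{u,v}) · P(s↮X)`: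
conditionally on `s ↮ X`, the events «`C_u ∈ 𝓤` off `C_s`» and «`C_v ∈ 𝓥` off `C_s`» are
positively correlated. -/
theorem bhk_two_outside_avoid (p : E → R) (hp : IsProbVec p) (ends : E → Sym2 V) (s u v : V)
    (X : Finset V) {𝓤 𝓥 : Set (Set V)} (h𝓤 : IsUpperSet 𝓤) (h𝓥 : IsUpperSet 𝓥) :
    prob p (clusterInEvent ends u 𝓤 ∩ avoidAll ends s (insert u X)) *
        prob p (clusterInEvent ends v 𝓥 ∩ avoidAll ends s (insert v X)) ≤
      prob p (clusterInEvent ends u 𝓤 ∩ clusterInEvent ends v 𝓥 ∩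
          avoidAll ends s (insert u (insert v X))) *
        prob p (avoidAll ends s X) := by
  classical
  have hF₁ : Monotone (fun W => 1 - outsideProb p ends u 𝓤 W) := fun W W' h => by
    have := outsideProb_anti hp ends u h𝓤 h
    simp only
    linarith
  have hF₂ : Monotone (fun W => 1 - outsideProb p ends v 𝓥 W) := fun W W' h => by
    have := outsideProb_anti hp ends v h𝓥 h
    simp only
    linarith
  have hF₁0 : ∀ W, 0 ≤ 1 - outsideProb p ends u 𝓤 W := fun W => by
    linarith [outsideProb_le_one hp ends u 𝓤 W]
  have hF₂0 : ∀ W, 0 ≤ 1 - outsideProb p ends v 𝓥 W := fun W => by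
    linarith [outsideProb_le_one hp ends v 𝓥 W]
  have key := bhk_univ_avoid p hp ends s X hF₁ hF₂ hF₁0 hF₂0
  set P := prob p (avoidAll ends s X) with hP
  set A := prob p (clusterInEvent ends u 𝓤 ∩ avoidAll ends s (insert u X)) with hA
  set B := prob p (clusterInEvent ends v 𝓥 ∩ avoidAll ends s (insert v X)) with hB
  set C := expect p (fun ω => outsideProb p ends u 𝓤 (cluster ends ω s) * outsideProb p ends v 𝓥 (cluster ends ω s) *
    (avoidAll ends s X).indicator 1 ω) with hC
  have eR : P = expect p fun ω => (avoidAll ends s X).indicator 1 ω := prob_eq_expect_indicator p _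
  have eA : A = expect p (fun ω => outsideProb p ends u 𝓤 (cluster ends ω s) * (avoidAll ends s X).indicator 1 ω) :=
    prob_outside_inter_avoid_eq_expect p ends s u X 𝓤
  have eB : B = expect p (fun ω => outsideProb p ends v 𝓥 (cluster ends ω s) * (avoidAll ends s X).indicator 1 ω) :=
    prob_outside_inter_avoid_eq_expect p ends s v X 𝓥
  have huv : C ≤ prob p (clusterInEvent ends u 𝓤 ∩ clusterInEvent ends v 𝓥 ∩
      avoidAll ends s (insert u (insert v X))) :=
    expect_outside_mul_le_prob hp ends s u v X h𝓤 h𝓥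
  have e1 : expect p (fun ω => (1 - outsideProb p ends u 𝓤 (cluster ends ω s)) * (avoidAll ends s X).indicator 1 ω) =
      P - A := by
    rw [eA, eR, ← expect_sub]
    exact congrArg (expect p) (funext fun ω => by simp only [Pi.sub_apply]; ring)
  have e2 : expect p (fun ω => (1 - outsideProb p ends v 𝓥 (cluster ends ω s)) * (avoidAll ends s X).indicator 1 ω) =
      P - B := by
    rw [eB, eR, ← expect_sub]
    exact congrArg (expect p) (funext fun ω => by simp only [Pi.sub_apply]; ring)
  have e3 : expect p (fun ω => (1 - outsideProb p ends u 𝓤 (cluster ends ω s)) * (1 - outsideProb p ends v 𝓥 (cluster ends ω s)) *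
      (avoidAll ends s X).indicator 1 ω) = P - A - B + C := by
    rw [eA, eB, eR, hC, ← expect_sub, ← expect_sub, ← expect_add]
    exact congrArg (expect p) (funext fun ω => by simp only [Pi.sub_apply, Pi.add_apply]; ring)
  rw [e1, e2, e3] at key
  have hP0 : 0 ≤ P := prob_nonneg hp _
  nlinarith [key, mul_nonneg (sub_nonneg.2 huv) hP0]

/-- **BHK, one inside and one outside event, with set avoidance** (negative): for up-sets `𝓤, 𝓥`
and a vertex `t`,
`P(C_s ∈ 𝓤, C_t ∈ 𝓥, s↮X∪{t}) · P(s↮X) ≤ P(C_s ∈ 𝓤, s↮X) · P(C_t ∈ 𝓥, s↮X∪{t})`: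
conditionally on `s ↮ X`, an increasing event of `C_s` and «`C_t ∈ 𝓥` off `C_s`» are negatively
correlated. (`t ∈ X` is `bhk_cross_cluster_avoid`.) -/
theorem bhk_inside_outside_avoid (p : E → R) (hp : IsProbVec p) (ends : E → Sym2 V) (s t : V)
    (X : Finset V) {𝓤 𝓥 : Set (Set V)} (h𝓤 : IsUpperSet 𝓤) (h𝓥 : IsUpperSet 𝓥) :
    prob p (clusterInEvent ends s 𝓤 ∩ clusterInEvent ends t 𝓥 ∩ avoidAll ends s (insert t X)) *
        prob p (avoidAll ends s X) ≤
      prob p (clusterInEvent ends s 𝓤 ∩ avoidAll ends s X) *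
        prob p (clusterInEvent ends t 𝓥 ∩ avoidAll ends s (insert t X)) := by
  classical
  have hF₁ : Monotone (𝓤.indicator (1 : Set V → R)) := monotone_indicator_one_of_isUpperSet h𝓤
  have hF₂ : Monotone (fun W => 1 - outsideProb p ends t 𝓥 W) := fun W W' h => by
    have := outsideProb_anti hp ends t h𝓥 h
    simp only
    linarith
  have hF₁0 : ∀ W, 0 ≤ 𝓤.indicator (1 : Set V → R) W :=
    fun W => Set.indicator_apply_nonneg fun _ => zero_le_one
  have hF₂0 : ∀ W, 0 ≤ 1 - outsideProb p ends t 𝓥 W := fun W => by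
    linarith [outsideProb_le_one hp ends t 𝓥 W]
  have key := bhk_univ_avoid p hp ends s X hF₁ hF₂ hF₁0 hF₂0
  set P := prob p (avoidAll ends s X) with hP
  set A := prob p (clusterInEvent ends s 𝓤 ∩ avoidAll ends s X) with hA
  set B := prob p (clusterInEvent ends t 𝓥 ∩ avoidAll ends s (insert t X)) with hB
  set C := prob p (clusterInEvent ends s 𝓤 ∩ clusterInEvent ends t 𝓥 ∩
    avoidAll ends s (insert t X)) with hC
  have eR : P = expect p fun ω => (avoidAll ends s X).indicator 1 ω := prob_eq_expect_indicator p _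
  have eA : A = expect p (fun ω => 𝓤.indicator 1 (cluster ends ω s) *
      (avoidAll ends s X).indicator 1 ω) :=
    prob_clusterInEvent_inter_eq_expect p ends s 𝓤 _
  have eB : B = expect p (fun ω => outsideProb p ends t 𝓥 (cluster ends ω s) * (avoidAll ends s X).indicator 1 ω) :=
    prob_outside_inter_avoid_eq_expect p ends s t X 𝓥
  have eC : C = expect p (fun ω => 𝓤.indicator 1 (cluster ends ω s) * outsideProb p ends t 𝓥 (cluster ends ω s) *
      (avoidAll ends s X).indicator 1 ω) :=
    prob_clusterIn_outside_inter_avoid_eq_expect p ends s t X 𝓤 𝓥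
  have e2 : expect p (fun ω => (1 - outsideProb p ends t 𝓥 (cluster ends ω s)) * (avoidAll ends s X).indicator 1 ω) =
      P - B := by
    rw [eB, eR, ← expect_sub]
    exact congrArg (expect p) (funext fun ω => by simp only [Pi.sub_apply]; ring)
  have e3 : expect p (fun ω => 𝓤.indicator 1 (cluster ends ω s) * (1 - outsideProb p ends t 𝓥 (cluster ends ω s)) *
      (avoidAll ends s X).indicator 1 ω) = A - C := by
    rw [eA, eC, ← expect_sub]
    exact congrArg (expect p) (funext fun ω => by simp only [Pi.sub_apply]; ring)
  rw [← eA, e2, e3] at key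
  nlinarith [key]

end Main

end Summit.Ventures.PercRepro2
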